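import Summits.ValiantsHypothesis.ValiantsHypothesis.Theses.FeketeSOS
import Summits.ValiantsHypothesis.ValiantsHypothesis.Theorems.FeketeNoSparseSplit.Negative.ModTwoShadow

/-!
# `FeketeNoSparseSplit` (crux stmt-ValiantsHypothesis-3997): the char-`p` shadow TRUTH — the line's `(p+3)/2` is not the
truth of the characteristic-`p` problem either, and reduction at the place over `p` is lossy from `p = 17` on (cdisprove cycle 4)

Negative-side small-model facts (refuter-cdisprove-stmt-ValiantsHypothesis-3997-g4-0), PROVED, no new facts; computations:
kit jobs j014278 (`p ≤ 23`) and j014513 (`p = 29, 31`), attached to the item.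
The line `Lines/cyclic-valuation-dichotomy.lean` bounds `|supp A| + |supp B| ≥ |supp Ā| + |supp B̄| ≥ ord₁ Ā + ord₁ B̄ + 2 = (p+3)/2`
(reduce a complex splitting `A·B = F_p` at a place over `p`; char-`p` fewnomial bound at the root `1`).  Two inequalities, two
losses, measured EXHAUSTIVELY (PARI/GP: all factorizations `Ā·B̄ = F̄_p` over `𝔽_p` and over `𝔽̄_p` — distribute `x`, the
`(p+1)/2` copies of `x - 1` and the linear factors of the Eulerian cofactor `G`, `F̄_p = ±x(x-1)^{(p-1)/2} G`, over the
splitting field `𝔽_{p^k}` of `G`):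

  `p`            :  3  5  7  11  13  17  19  23  29  31
  `(p+3)/2`      :  3  4  5   7   8  10  11  13  16  17   (the lever = the line's certificate)
  `min over 𝔽_p` :  3  4  7   9  10  13  13  21  22  25
  `min over 𝔽̄_p`:  3  4  7   9  10  13  13  21  22  25   (`k` = 1,1,2,4,4,2,6,5,8,6; always attained `𝔽_p`-rationally)
  `min over ℂ`   :  3  4  7   9  10  14  15  23  22   ?   (exhaustive over all `2^{p-3}` complex splittings, cycle 1 / item evidence)

(i) The second inequality is far from tight: the char-`p` problem itself has minimum `≈ 0.7p – 0.9p`, not `p/2` — the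
multiplicity-at-`1` lever ignores the cofactor `G` entirely; a support theory for `(x-1)^i·(divisors of G)` in characteristic
`p` is where the missing `≈ p/2 - Θ(√p)` of the line lives.  (ii) The first inequality is lossy too: at `p = 17, 19, 23` the
char-`p` minimum is BELOW the complex one, witnessed over `𝔽_17` itself by `fekete_seventeen_charP_split`:
`F̄_17 = (1 + 3X - 4X² - 4X⁵ + 3X⁶ + X⁷)·(X - 2X² - 8X³ + X⁵ - 8X⁷ - 2X⁸ + X⁹)`, support-sum `6 + 7 = 13 < 14` (both factors
palindromic; over `ℤ` the product is `F_17 + 17·(-X³ - X⁴ + 2X⁵ + 2X¹² - X¹³ - X¹⁴)`, a near-splitting of `F_17` whose defect is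
`17`-divisible and supported on six coefficients).  Neither loss threatens the crux (`p^{1/2+δ} ≪ (p+3)/2`); both bound what
this line can certify, for the record of the sibling cruxes 3996/3998 where every constant matters.
-/

namespace Summit.ValiantsHypothesis.Theorems.FeketeNoSparseSplit.Negative

open Polynomial Finset

attribute [local instance] fact_prime_seventeen

section CharPShadow

/-- `F₁₇` reduced modulo `17`, explicitly (quadratic residues mod 17: `1, 2, 4, 8, 9, 13, 15, 16`). -/
theorem fekete_seventeen_mod_seventeen_eq :
    (∑ m ∈ Finset.range 17, C ((legendreSym 17 m : ℤ) : ZMod 17) * X ^ m) =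
      X + X ^ 2 - X ^ 3 + X ^ 4 - X ^ 5 - X ^ 6 - X ^ 7 + X ^ 8 + X ^ 9 - X ^ 10 - X ^ 11 - X ^ 12 + X ^ 13
        - X ^ 14 + X ^ 15 + X ^ 16 := by
  simp [Finset.sum_range_succ]
  norm_num
  ring

/-- The 6-term factor `1 + 3X - 4X² - 4X⁵ + 3X⁶ + X⁷` in injective-exponent form. -/
theorem A17_eq_sum : (1 + 3 * X - 4 * X ^ 2 - 4 * X ^ 5 + 3 * X ^ 6 + X ^ 7 : (ZMod 17)[X]) =
    ∑ i : Fin 6, C ((![1, 3, -4, -4, 3, 1] : Fin 6 → ZMod 17) i) * X ^ ((![0, 1, 2, 5, 6, 7] : Fin 6 → ℕ) i) := by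
  simp [Fin.sum_univ_succ, C_ofNat]
  ring

/-- `1 + 3X - 4X² - 4X⁵ + 3X⁶ + X⁷` has exactly six monomials over `𝔽₁₇`. -/
theorem card_support_A17 :
    ((1 + 3 * X - 4 * X ^ 2 - 4 * X ^ 5 + 3 * X ^ 6 + X ^ 7 : (ZMod 17)[X])).support.card = 6 := by
  rw [A17_eq_sum]
  apply card_support_eq'
  · decide
  · intro i; fin_cases i <;> decide

/-- The 7-term factor `X - 2X² - 8X³ + X⁵ - 8X⁷ - 2X⁸ + X⁹` in injective-exponent form. -/
theorem B17_eq_sum : (X - 2 * X ^ 2 - 8 * X ^ 3 + X ^ 5 - 8 * X ^ 7 - 2 * X ^ 8 + X ^ 9 : (ZMod 17)[X]) =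
    ∑ i : Fin 7, C ((![1, -2, -8, 1, -8, -2, 1] : Fin 7 → ZMod 17) i) *
      X ^ ((![1, 2, 3, 5, 7, 8, 9] : Fin 7 → ℕ) i) := by
  simp [Fin.sum_univ_succ, C_ofNat]
  ring

/-- `X - 2X² - 8X³ + X⁵ - 8X⁷ - 2X⁸ + X⁹` has exactly seven monomials over `𝔽₁₇`. -/
theorem card_support_B17 :
    ((X - 2 * X ^ 2 - 8 * X ^ 3 + X ^ 5 - 8 * X ^ 7 - 2 * X ^ 8 + X ^ 9 : (ZMod 17)[X])).support.card = 7 := by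
  rw [B17_eq_sum]
  apply card_support_eq'
  · decide
  · intro i; fin_cases i <;> decide

/-- **The char-`17` shadow beats the complex truth**: `F̄_17 = (1 + 3X - 4X² - 4X⁵ + 3X⁶ + X⁷)·(X - 2X² - 8X³ + X⁵ - 8X⁷ - 2X⁸ + X⁹)`
in `𝔽_17[X]`, support-sum `13` — below the minimum `14` over ALL complex splittings of `F_17` (exhaustive, cycle 1), above the
line's certificate `(17+3)/2 = 10`; `13` is the exact char-`17` minimum (j014278).  [computation: kit j014278] -/
theorem fekete_seventeen_charP_split : ∃ A B : (ZMod 17)[X],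
    A * B = ∑ m ∈ Finset.range 17, C ((legendreSym 17 m : ℤ) : ZMod 17) * X ^ m ∧
    A.support.card + B.support.card = 13 := by
  refine ⟨1 + 3 * X - 4 * X ^ 2 - 4 * X ^ 5 + 3 * X ^ 6 + X ^ 7,
    X - 2 * X ^ 2 - 8 * X ^ 3 + X ^ 5 - 8 * X ^ 7 - 2 * X ^ 8 + X ^ 9, ?_, ?_⟩
  · rw [fekete_seventeen_mod_seventeen_eq]
    have h17 : (17 : (ZMod 17)[X]) = 0 := by exact_mod_cast CharP.cast_eq_zero (ZMod 17)[X] 17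
    have key : (1 + 3 * X - 4 * X ^ 2 - 4 * X ^ 5 + 3 * X ^ 6 + X ^ 7 : (ZMod 17)[X]) *
        (X - 2 * X ^ 2 - 8 * X ^ 3 + X ^ 5 - 8 * X ^ 7 - 2 * X ^ 8 + X ^ 9) =
        (X + X ^ 2 - X ^ 3 + X ^ 4 - X ^ 5 - X ^ 6 - X ^ 7 + X ^ 8 + X ^ 9 - X ^ 10 - X ^ 11 - X ^ 12 + X ^ 13
          - X ^ 14 + X ^ 15 + X ^ 16)
        + 17 * (-X ^ 3 - X ^ 4 + 2 * X ^ 5 + 2 * X ^ 12 - X ^ 13 - X ^ 14) := by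
      ring
    rw [key, h17, zero_mul, add_zero]
  · rw [card_support_A17, card_support_B17]

end CharPShadow

end Summit.ValiantsHypothesis.Theorems.FeketeNoSparseSplit.Negative
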